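import Mathlib
import HarnessLib

/-!
# The periodized stationary phase formula over `ℤ/p^m ℤ` (Dąbrowski–Fisher 1997, Theorem 1.8 (a))

* R. Dąbrowski, B. Fisher, *A stationary phase formula for exponential sums over `ℤ/p^mℤ` and
  applications to GL(3)-Kloosterman sums*, Acta Arith. 80 (1997) 1–48 [DabrowskiFisher1997],
  §1, Notation 1.1, (1.1) and THEOREM 1.8 (a), p. 10 (read 2026-08-15 from the IMPAN copy):

  > Notation 1.1: `p` is a prime, `V` a smooth scheme of dimension `n ≥ 1` over `ℤ_p`,
  > `f : V → 𝔸¹` a `ℤ_p`-morphism, `D ⊆ V` the scheme of critical points of `f`, `m > 1`,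
  > `S = ∑_{x ∈ V(ℤ/p^mℤ)} e^{2πi f(x)/p^m}` (1.1).
  > Theorem 1.8. Let `m` and `j` be positive integers, with `j ≤ m`. For `x̄ ∈ V(ℤ/p^jℤ)` let
  > `S_x̄` be the sum over all `x ∈ V(ℤ/p^mℤ)` that reduce to `x̄`, so that `S = ∑_x̄ S_x̄`.
  > (a) If `2j ≤ m` then `S_x̄ = 0` unless `x̄ ∈ D(ℤ/p^jℤ)`. Now let `m = 2j` or `2j + 1` and let
  > `x ∈ V(ℤ/p^mℤ)` map to `x̄ ∈ D(ℤ/p^jℤ)`. If `m = 2j` then `S_x̄ = p^{nm/2} e^{2πi f(x)/p^m}`.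
  > If `m = 2j+1` then `S_x̄ = p^{nm/2} e^{2πi f(x)/p^m} G₁(H_x, p^{-j} grad f(x))`.

  (Remark 1.9 (2), p. 11: part (a) "follows from the fact that the sum of a non-trivial character
  over a finite group vanishes"; ANY prime `p`, including `p = 2`, is allowed in (a).)

We vendor part (a) for the affine space `V = 𝔸ⁿ_{ℤ}`, `f ∈ ℤ[X_1, …, X_n]` (a `ℤ_p`-morphism
`𝔸ⁿ → 𝔸¹` for every `p`; `D(ℤ/p^jℤ)` = common zeros of the partial derivatives `∂f/∂X_i` mod
`p^j`), in two named facts: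

* `DabrowskiFisher1997_fibre_eq_zero` — first sentence of (a): for `2j ≤ m`, the fibre sum `S_x̄`
  over a NON-critical `x̄ ∈ (ℤ/p^j)ⁿ` vanishes;
* `DabrowskiFisher1997_even` — the case `m = 2j`: for `x̄` critical and any `x` over `x̄`,
  `S_x̄ = p^{nj} · e^{2πi f(x)/p^{2j}}` (so the value does not depend on the lift `x`).

Summing over `x̄` gives the global form used downstream,
`∑_{x ∈ (ℤ/p^{2j})ⁿ} e(f(x)/p^{2j}) = p^{nj} ∑_{ā ∈ (ℤ/p^j)ⁿ, grad f(ā) ≡ 0} e(f(ã)/p^{2j})`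
(`ã` any lift, e.g. the least-residue lift).  With `p = 2`, `j = c`, `n = k` and
`f = Φ(x; ·; y)` the chain phase `∑_i P_i(w_i) + w_i w_{i+1}`, this is
`Summit.QuantumAdvantage.QuantumAdvantage.Theses.TwoAdicStationaryPhase.TspChainLocalisation`
(stmt-QuantumAdvantage-2650) and, divided by `(2^c)^{k+1}`, part (i) of `TspAmplitudeAverage`
(stmt-2647); with `n = K` path variables it is the localisation step (E) of the informal
`TspMultiRegister` (stmt-2727).  Grounds those items (fact ∘ specialisation; the route's COUNT of
critical points is not in the source — cf. Remark 1.9 (3): "it is hard to estimate the number of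
points in `D(ℤ/p^jℤ)`").

NOT vendored here: the odd case `m = 2j + 1` of (a) (it carries the normalized Gauss sum
`G₁(A; v)` of Definition 1.2 with its special `p = 2` convention `e^{2πi ᵗxAx/p^{h+1}}`; the route's
`TspOddModulus` (stmt-2652) states that case at `p = 2` with the Gauss factor written out as
`∑_{u ∈ {0,1}^k} e((Φ(ã + 2^c u) − Φ(ã))/2^{2c+1})`), Proposition 1.3 (c) (`G₁(A; v)` is `0` or
`p^{(n−r)/2}` times a root of unity, `r = rank_{𝔽_p} A` — the printed shape of `TspOddGaussBound`,
stmt-2649), part (b) and Corollary 1.10.  The character is written literally as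
`exp(2πi · z.val / N)` (the form of the route statements; equal to Mathlib's `ZMod.stdAddChar`,
bridged here by `eZMod_eq_stdAddChar` / `norm_eZMod`, cf. `Literature.QuantumAdvantage.echar_eq_stdAddChar` in
`Computability/QuantumComplexity/PolyPhaseCircuit.lean`).  Users take `(h : DabrowskiFisher1997_even)`.
-/

namespace Literature.NumberTheory.GaussSums

open scoped BigOperators

/-- `e(z/N) := exp(2πi z/N)` for `z ∈ ℤ/N`, through the least-residue representative (the literal
form used by the route statements; `= ZMod.stdAddChar z`). [folklore] -/
noncomputable def eZMod (N : ℕ) (z : ZMod N) : ℂ :=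
  Complex.exp (2 * Real.pi * Complex.I * ((z.val : ℂ) / (N : ℂ)))

/-- `eZMod` is Mathlib's standard additive character of `ℤ/N` (bridge for consumers; cf.
`Literature.QuantumAdvantage.echar_eq_stdAddChar`). [folklore] -/
theorem eZMod_eq_stdAddChar (N : ℕ) [NeZero N] (z : ZMod N) : eZMod N z = ZMod.stdAddChar z := by
  rw [ZMod.stdAddChar_apply, ZMod.toCircle_apply, eZMod]
  congr 1
  ring

/-- `|eZMod N z| = 1`. [folklore] -/
theorem norm_eZMod (N : ℕ) [NeZero N] (z : ZMod N) : ‖eZMod N z‖ = 1 := by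
  rw [eZMod_eq_stdAddChar, ZMod.stdAddChar_apply, Circle.norm_coe]

/-- Reduction `ℤ/p^m → ℤ/p^j` for `j ≤ m`. [cite: DabrowskiFisher1997, Thm 1.8] -/
def redPow (p j m : ℕ) (h : j ≤ m) : ZMod (p ^ m) →+* ZMod (p ^ j) :=
  ZMod.castHom (pow_dvd_pow p h) (ZMod (p ^ j))

open Classical in
/-- **Dąbrowski–Fisher, Theorem 1.8 (a), first sentence** (`V = 𝔸ⁿ_ℤ`): let `p` be prime,
`f ∈ ℤ[X_1,…,X_n]`, `j, m` positive integers with `2j ≤ m`, and `x̄ ∈ (ℤ/p^j)ⁿ` NOT a critical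
point of `f` mod `p^j` (some `∂f/∂X_i (x̄) ≠ 0` in `ℤ/p^j`).  Then the fibre sum
`S_x̄ = ∑_{x ∈ (ℤ/p^m)ⁿ, x ≡ x̄ (p^j)} e(f(x)/p^m)` vanishes.
Grounds `Summit.QuantumAdvantage.QuantumAdvantage.Theses.TwoAdicStationaryPhase.TspChainLocalisation`.
[cite: DabrowskiFisher1997, Thm 1.8 (a)] -/
def DabrowskiFisher1997_fibre_eq_zero : Prop :=
  ∀ (p : ℕ) [Fact p.Prime] (n j m : ℕ), 0 < j → ∀ (hjm : 2 * j ≤ m) (f : MvPolynomial (Fin n) ℤ)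
    (xbar : Fin n → ZMod (p ^ j)),
    (∃ i : Fin n, MvPolynomial.aeval xbar (MvPolynomial.pderiv i f) ≠ 0) →
      (∑ x ∈ (Finset.univ.filter fun x : Fin n → ZMod (p ^ m) =>
          ∀ i, redPow p j m (by omega) (x i) = xbar i),
        eZMod (p ^ m) (MvPolynomial.aeval x f)) = 0

open Classical in
/-- **Dąbrowski–Fisher, Theorem 1.8 (a), case `m = 2j`** (`V = 𝔸ⁿ_ℤ`): let `p` be prime,
`f ∈ ℤ[X_1,…,X_n]`, `j ≥ 1`, and let `x ∈ (ℤ/p^{2j})ⁿ` reduce to a CRITICAL point `x̄` of `f`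
mod `p^j` (`∂f/∂X_i (x̄) = 0` in `ℤ/p^j` for all `i`).  Then the fibre sum over `x̄` is
`S_x̄ = ∑_{x' ≡ x̄ (p^j)} e(f(x')/p^{2j}) = p^{nj} · e(f(x)/p^{2j})`
(`p^{nm/2}` with `m = 2j`; in particular the right side does not depend on the lift `x` of `x̄`).
Summed over `x̄` (with `DabrowskiFisher1997_fibre_eq_zero`):
`∑_{x} e(f(x)/p^{2j}) = p^{nj} ∑_{ā critical} e(f(ã)/p^{2j})` — at `p = 2`, `j = c` this is the
route's `TspChainLocalisation` / `TspAmplitudeAverage` (i) for the chain phase.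
Grounds `Summit.QuantumAdvantage.QuantumAdvantage.Theses.TwoAdicStationaryPhase.TspAmplitudeAverage`.
[cite: DabrowskiFisher1997, Thm 1.8 (a)] -/
def DabrowskiFisher1997_even : Prop :=
  ∀ (p : ℕ) [Fact p.Prime] (n j : ℕ), 0 < j → ∀ (f : MvPolynomial (Fin n) ℤ)
    (x : Fin n → ZMod (p ^ (2 * j))),
    (∀ i : Fin n, MvPolynomial.aeval (fun k => redPow p j (2 * j) (by omega) (x k))
        (MvPolynomial.pderiv i f) = 0) →
      (∑ x' ∈ (Finset.univ.filter fun x' : Fin n → ZMod (p ^ (2 * j)) =>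
          ∀ i, redPow p j (2 * j) (by omega) (x' i) = redPow p j (2 * j) (by omega) (x i)),
        eZMod (p ^ (2 * j)) (MvPolynomial.aeval x' f)) =
        (p : ℂ) ^ (n * j) * eZMod (p ^ (2 * j)) (MvPolynomial.aeval x f)

end Literature.NumberTheory.GaussSums

/-! ## Proof of Theorem 1.8 (a), first sentence: `DabrowskiFisher1997_fibre_eq_zero_holds`

[cite: DabrowskiFisher1997, proof of Theorem 1.8 (a), p. 20, and Remark 1.9 (2), p. 11]
("(a) … follows from the fact that the sum of a non-trivial character over a finite group
vanishes").  The printed proof (p. 20): for `x` in the fibre `ϱ⁻¹(x̄)` and `y ∈ (ℤ/p^jℤ)ⁿ`,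
`x + p^{m-j} y` runs through the fibre and, since `m ≥ 2j`,
`f(x + p^{m-j} y) = f(x) + p^{m-j} grad f(x)·y ∈ ℤ/p^mℤ`; hence
`S_x̄ = ∑_x e(f(x)/p^m) · p^{-nj} ∑_y e(grad f(x)·y/p^j)` and the inner character sum vanishes
unless `grad f(x) ≡ 0 (mod p^j)`, i.e. unless `x̄ ∈ D(ℤ/p^jℤ)`.

We formalize the same argument with the single translate `y = e_{i₀}`, where `∂_{i₀} f(x̄) ≠ 0`
in `ℤ/p^jℤ` (a genuinely shorter road in Lean than the double sum): the shift
`x ↦ x + p^{m-j} e_{i₀}` is a bijection of the fibre (`p^{m-j} ≡ 0 (mod p^j)` as `j ≤ m - j`),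
and by the first-order Taylor expansion over `ℤ/p^mℤ` (where `(p^{m-j})² = 0`) it multiplies
every term `e(f(x)/p^m)` by the constant `e(∂_{i₀} f(x̄)/p^j) ≠ 1`; so `S_x̄ = e(·) S_x̄` forces
`S_x̄ = 0` — which is exactly how the vanishing of a non-trivial character sum is proved.
-/

namespace Literature.NumberTheory.GaussSums

open scoped BigOperators

/-- First-order Taylor expansion of an integer polynomial over the "dual numbers": if `t * t = 0`
in a commutative ring `R` then `f(x + t e_i) = f(x) + t · (∂_i f)(x)`.
[cite: DabrowskiFisher1997, proof of Thm 1.8 (a), p. 20 (`f(x + p^{m-j}y) = f(x) + p^{m-j} grad f(x)·y`)] -/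
theorem aeval_add_single_of_mul_self_eq_zero {σ R : Type*} [CommRing R] [DecidableEq σ]
    (f : MvPolynomial σ ℤ) (x : σ → R) (i : σ) (t : R) (ht : t * t = 0) :
    MvPolynomial.aeval (x + Pi.single i t) f =
      MvPolynomial.aeval x f + t * MvPolynomial.aeval x (MvPolynomial.pderiv i f) := by
  induction f using MvPolynomial.induction_on with
  | C a => simp
  | add p q hp hq => simp only [map_add, hp, hq]; ring
  | mul_X p k hp =>
    simp only [map_mul, map_add, MvPolynomial.aeval_X, hp, MvPolynomial.pderiv_mul,
      MvPolynomial.pderiv_X, Pi.add_apply]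
    rcases eq_or_ne k i with rfl | hk
    · simp only [Pi.single_eq_same, map_one]
      linear_combination (MvPolynomial.aeval x (MvPolynomial.pderiv k p)) * ht
    · simp only [Pi.single_eq_of_ne hk, map_zero]
      ring

/-- In `ℤ/p^mℤ`, `(p^{m-j})² = 0` as soon as `2j ≤ m`. [folklore] -/
theorem natCast_pow_sub_mul_self_eq_zero (p j m : ℕ) (hjm : 2 * j ≤ m) :
    ((p ^ (m - j) : ℕ) : ZMod (p ^ m)) * ((p ^ (m - j) : ℕ) : ZMod (p ^ m)) = 0 := by
  rw [← Nat.cast_mul, ZMod.natCast_eq_zero_iff, ← pow_add]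
  exact pow_dvd_pow p (by omega)

/-- `p^{m-j} ≡ 0 (mod p^j)` when `2j ≤ m`: the shift by `p^{m-j} e_i` preserves the fibres of
`(ℤ/p^m)ⁿ → (ℤ/p^j)ⁿ`. [folklore] -/
theorem redPow_natCast_pow_sub (p j m : ℕ) (h : j ≤ m) (hjm : 2 * j ≤ m) :
    redPow p j m h ((p ^ (m - j) : ℕ) : ZMod (p ^ m)) = 0 := by
  rw [map_natCast, ZMod.natCast_eq_zero_iff]
  exact pow_dvd_pow p (by omega)

/-- Reduction mod `p^j` commutes with evaluation of integer polynomials. [folklore] -/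
theorem redPow_aeval {σ : Type*} (p j m : ℕ) (h : j ≤ m) (g : MvPolynomial σ ℤ)
    (x : σ → ZMod (p ^ m)) :
    redPow p j m h (MvPolynomial.aeval x g) =
      MvPolynomial.aeval (fun k => redPow p j m h (x k)) g :=
  MvPolynomial.comp_aeval_apply x (redPow p j m h).toIntAlgHom g

/-- The character identity `e((a + p^{m-j} b)/p^m) = e(a/p^m) · e((b mod p^j)/p^j)`. [folklore] -/
theorem eZMod_add_natCast_pow_sub_mul (p j m : ℕ) [NeZero p] (h : j ≤ m)
    (a b : ZMod (p ^ m)) :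
    eZMod (p ^ m) (a + ((p ^ (m - j) : ℕ) : ZMod (p ^ m)) * b) =
      eZMod (p ^ m) a * eZMod (p ^ j) (redPow p j m h b) := by
  rw [eZMod_eq_stdAddChar, eZMod_eq_stdAddChar, eZMod_eq_stdAddChar, AddChar.map_add_eq_mul]
  congr 1
  obtain ⟨k, rfl⟩ := ZMod.natCast_zmod_surjective b
  rw [map_natCast, ← Nat.cast_mul, ZMod.stdAddChar_apply, ZMod.stdAddChar_apply,
    ZMod.toCircle_natCast, ZMod.toCircle_natCast]
  congr 1
  have hp : (p : ℂ) ≠ 0 := Nat.cast_ne_zero.mpr (NeZero.ne p)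
  have hpm : ((p ^ m : ℕ) : ℂ) = (p : ℂ) ^ (m - j) * (p : ℂ) ^ j := by
    rw [← pow_add, Nat.sub_add_cancel h, Nat.cast_pow]
  rw [hpm]
  push_cast
  field_simp

/-- A non-trivial value of the standard character: `e(z/N) ≠ 1` for `z ≠ 0` in `ℤ/Nℤ`. [folklore] -/
theorem eZMod_ne_one {N : ℕ} [NeZero N] {z : ZMod N} (hz : z ≠ 0) : eZMod N z ≠ 1 := by
  rw [eZMod_eq_stdAddChar]
  intro h1
  refine hz (ZMod.injective_stdAddChar (N := N) ?_)
  rw [h1, AddChar.map_zero_eq_one]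

/-- **Dąbrowski–Fisher 1997, Theorem 1.8 (a), first sentence** (for `V = 𝔸ⁿ_ℤ`), discharged:
for `2j ≤ m` the fibre sum `S_x̄` over a non-critical `x̄ ∈ (ℤ/p^j)ⁿ` vanishes.
[cite: DabrowskiFisher1997, Thm 1.8 (a) and its proof, p. 20; Remark 1.9 (2), p. 11] -/
theorem DabrowskiFisher1997_fibre_eq_zero_holds : DabrowskiFisher1997_fibre_eq_zero := by
  intro p hp n j m hj hjm f xbar hcrit
  classical
  obtain ⟨i₀, hi₀⟩ := hcrit
  have hjm' : j ≤ m := by omega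
  -- the constant multiplier `c = e(∂_{i₀} f(x̄)/p^j) ≠ 1`
  have hc : eZMod (p ^ j) (MvPolynomial.aeval xbar (MvPolynomial.pderiv i₀ f)) ≠ 1 :=
    eZMod_ne_one hi₀
  -- it suffices to show `c * S = S`
  refine (mul_left_eq_self₀.mp ?_).resolve_left hc
  rw [Finset.mul_sum]
  -- the shift `x ↦ x + p^{m-j} e_{i₀}` kills the reductions mod `p^j`
  have hv0 : ∀ i, redPow p j m hjm'
      ((Pi.single i₀ ((p ^ (m - j) : ℕ) : ZMod (p ^ m)) : Fin n → ZMod (p ^ m)) i) = 0 := by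
    intro i
    rw [Pi.single_apply]
    split_ifs
    · exact redPow_natCast_pow_sub p j m hjm' hjm
    · exact map_zero _
  refine Finset.sum_equiv (Equiv.addRight (Pi.single i₀ ((p ^ (m - j) : ℕ) : ZMod (p ^ m))))
    (fun x => ?_) (fun x hx => ?_)
  · -- the shift is a bijection of the fibre
    simp only [Finset.mem_filter, Finset.mem_univ, true_and, Equiv.coe_addRight, Pi.add_apply,
      map_add, hv0, add_zero]
  · -- and multiplies each term by `c`
    simp only [Finset.mem_filter, Finset.mem_univ, true_and] at hx
    have hx' : (fun k => redPow p j m hjm' (x k)) = xbar := funext hx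
    rw [Equiv.coe_addRight,
      aeval_add_single_of_mul_self_eq_zero f x i₀ _ (natCast_pow_sub_mul_self_eq_zero p j m hjm),
      eZMod_add_natCast_pow_sub_mul p j m hjm', redPow_aeval, hx', mul_comm]

end Literature.NumberTheory.GaussSums
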